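import Literature.AlgebraicGeometry.HodgeTheory.RegularFormRealizationNaturality
import Literature.AlgebraicGeometry.Motives.ComplexPointsEhresmann
import HarnessLib

/-!
# Coordinates on a basic open of an affine variety: `Γ(Y_g, 𝒪) = Γ(Y, 𝒪)[1/g]` presented by `(x, 1/g)`

[topic AlgebraicGeometry/HodgeTheory]

Let `Y` be an affine `ℂ`-scheme with coordinates `x : Fin N → Γ(Y, 𝒪)`
(`coordPresentation Y x = φ_x : ℂ[T₀, …, T_{N-1}] → Γ(Y, 𝒪)`, `RegularFormRealization`), let
`G ∈ ℂ[T]`, `g = φ_x(G) ∈ Γ(Y, 𝒪)`, and let `Y_g = Y|_{D(g)}` be the basic open subscheme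
(`Motives.openSubschemeOver Y (Y.basicOpen g)`, open immersion `ι : Y_g ⟶ Y`,
`Motives.openSubschemeOverι`). Then `Γ(Y_g, 𝒪) = Γ(Y, 𝒪)_g` [Hartshorne1977, II Prop. 2.2 (b) /
Ex. 2.16; Mathlib `AlgebraicGeometry.Γ_restrict_isLocalization`], so `Y_g` is affine with the
`N + 1` coordinates `x' = (ι^* x₀, …, ι^* x_{N-1}, (ι^* g)⁻¹)`, i.e.
`Γ(Y_g, 𝒪) = ℂ[T₀, …, T_N]/(I, T_N · G − 1)` for `Γ(Y, 𝒪) = ℂ[T]/I` — the presentation of a basic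
open used to write down the algebraic Čech–de Rham complex of an affine open cover
[Grothendieck1966, p. 96 (6); Hartshorne1975, Ch. II §1]. This file constructs these coordinates
on the tree's carriers:

* `isUnit_appTop_openSubschemeOverι_basicOpen` — `ι^* g` is a unit in `Γ(Y_g, 𝒪)`
  (`IsLocalization.Away.algebraMap_isUnit`);
* `basicOpenCoord x G : Fin (N + 1) → Γ(Y_g, 𝒪)` — the coordinates `(ι^* x, (ι^* g)⁻¹)`, and
  `basicOpenLift N : Fin N → ℂ[T₀, …, T_N]`, `Tⱼ ↦ Tⱼ` — the polynomial lift of `ι` on them;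
* `appTop_eq_coordPresentation_basicOpenCoord` — `ι^*(xⱼ) = φ_{x'}(Tⱼ)`: the datum `hF` consumed by
  the naturality square of Grothendieck's comparison map along `ι` (`deRhamComparison_map_eq`,
  node P2-nat of the lane's Route P);
* `coordPresentation_basicOpenCoord_rename` — `φ_{x'}(f(T₀, …, T_{N-1})) = ι^*(φ_x f)`, and
  `coordPresentation_basicOpenCoord_X_last_mul` — `φ_{x'}(T_N) · ι^*(g) = 1`; hence the relations
  `map_basicOpenLift_le_ker_coordPresentation_basicOpenCoord` (`I · ℂ[T₀, …, T_N] ⊆ ker φ_{x'}`)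
  and `X_last_mul_rename_sub_one_mem_ker` (`T_N · G − 1 ∈ ker φ_{x'}`);
* `coordPresentation_basicOpenCoord_surjective` — **`φ_{x'}` is onto when `φ_x` is**: every
  section over `D(g)` is `ι^*(s) · (ι^* g)⁻ⁿ` (`IsLocalization.Away.surj`), the image of `S · T_Nⁿ`;
* the instance `isAffine_openSubschemeOver_basicOpen_left` (`Y_g` is affine).

Everything is proved; the only definitions (with bodies) are `basicOpenLift` and `basicOpenCoord`;
no named facts (net debt 0). Not here: the reverse inclusion `ker φ_{x'} ⊆ (I, T_N · G − 1)`
(Mathlib `IsLocalization.Away` / `Localization.awayEquivAdjoin`), which the comparison maps of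
Route P do not need (they are typed against `ker φ_{x'}` itself).

## References

* [Hartshorne1977] R. Hartshorne, *Algebraic Geometry*, GTM 52, II Prop. 2.2 (b), Ex. 2.16
  (`Γ(D(f), 𝒪_X) = A_f`), II §3.
* [Grothendieck1966] A. Grothendieck, *On the de Rham cohomology of algebraic varieties*, Publ.
  Math. IHÉS 29 (1966), p. 96 (4)–(6).
* [Hartshorne1975] R. Hartshorne, *On the De Rham cohomology of algebraic varieties*, Publ. Math.
  IHÉS 45 (1975), Ch. II §1 (embedded affine pieces).
-/

noncomputable section

open CategoryTheory AlgebraicGeometry MvPolynomial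
open Literature.AlgebraicGeometry.Motives

namespace Literature.AlgebraicGeometry.HodgeTheory

section HodgeTheory

variable {Y : Motives.SchemeOver ℂ} {N : ℕ}

/-! ### Sections of `Y` restricted to an open subscheme -/

/-- `ι^*` on global sections, for the open immersion `ι : Y|_O ⟶ Y`, is the structure map
`Γ(Y, 𝒪) → Γ(O, 𝒪_Y|_O)` of the `Γ(Y, 𝒪)`-algebra of sections over `O` (Mathlib
`AlgebraicGeometry.ΓRestrictAlgebra`). [cite: Hartshorne1977, II §3] -/
theorem appTop_openSubschemeOverι_eq_algebraMap (O : Y.left.Opens) (s : Γ(Y.left, ⊤)) :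
    (Motives.openSubschemeOverι Y O).left.appTop s = algebraMap Γ(Y.left, ⊤) Γ((O : Scheme), ⊤) s := by
  rw [RingHom.algebraMap_toAlgebra]
  rfl

/-- **The basic open subscheme `Y_g` of an affine `Y` is affine.** [cite: Hartshorne1977, II Prop. 2.2 (b)] -/
instance isAffine_openSubschemeOver_basicOpen_left [IsAffine Y.left] (g : Γ(Y.left, ⊤)) :
    IsAffine (Motives.openSubschemeOver Y (Y.left.basicOpen g)).left :=
  inferInstanceAs <| IsAffine (Y.left.basicOpen g : Scheme)

/-- **`ι^* g` is a unit on the basic open `D(g)`**: for `Y` affine, `Γ(Y_g, 𝒪) = Γ(Y, 𝒪)_g`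
(Mathlib `AlgebraicGeometry.Γ_restrict_isLocalization`), so `g` becomes invertible there.
[cite: Hartshorne1977, II Prop. 2.2 (b)] -/
theorem isUnit_appTop_openSubschemeOverι_basicOpen [IsAffine Y.left] (g : Γ(Y.left, ⊤)) :
    IsUnit ((Motives.openSubschemeOverι Y (Y.left.basicOpen g)).left.appTop g) := by
  rw [appTop_openSubschemeOverι_eq_algebraMap]
  exact IsLocalization.Away.algebraMap_isUnit (S := Γ((Y.left.basicOpen g : Scheme), ⊤)) g

/-! ### The coordinates `(ι^* x, (ι^* g)⁻¹)` on `Y_g` and the lift `Tⱼ ↦ Tⱼ` -/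

/-- The polynomial lift `Tⱼ ↦ Tⱼ` (`j < N`) of the open immersion `ι : Y_g ⟶ Y` on the coordinates
`x` of `Y` and `(ι^* x, (ι^* g)⁻¹)` of `Y_g`: the substitution `ℂ[T₀, …, T_{N-1}] → ℂ[T₀, …, T_N]`
forgetting the last variable. [cite: Hartshorne1975, Ch. II §1] -/
def basicOpenLift (N : ℕ) : Fin N → MvPolynomial (Fin (N + 1)) ℂ :=
  fun j ↦ X (Fin.castSucc j)

/-- `basicOpenLift N j = Tⱼ` (definitional). [cite: Hartshorne1975, Ch. II §1] -/
@[simp]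
theorem basicOpenLift_apply (j : Fin N) : basicOpenLift N j = X (Fin.castSucc j) :=
  rfl

/-- Substitution along `basicOpenLift` is the renaming `Tⱼ ↦ Tⱼ` (`rename Fin.castSucc`): two
`ℂ`-algebra maps out of `ℂ[T]` agreeing on the variables. [cite: Hartshorne1975, Ch. II §1] -/
theorem bind₁_basicOpenLift :
    (bind₁ (basicOpenLift N) : MvPolynomial (Fin N) ℂ →ₐ[ℂ] MvPolynomial (Fin (N + 1)) ℂ) =
      rename Fin.castSucc := by
  refine MvPolynomial.algHom_ext fun j ↦ ?_
  rw [bind₁_X_right, rename_X, basicOpenLift_apply]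

/-- `f(basicOpenLift) = f(T₀, …, T_{N-1}) ∈ ℂ[T₀, …, T_N]`. [cite: Hartshorne1975, Ch. II §1] -/
theorem bind₁_basicOpenLift_apply (f : MvPolynomial (Fin N) ℂ) :
    bind₁ (basicOpenLift N) f = rename Fin.castSucc f := by
  rw [bind₁_basicOpenLift]

variable [IsAffine Y.left] (x : Fin N → Γ(Y.left, ⊤)) (g : Γ(Y.left, ⊤))

/-- **The coordinates `x' = (ι^* x₀, …, ι^* x_{N-1}, (ι^* g)⁻¹)` on the basic open `Y_g`**: the
restrictions of the coordinates of `Y` followed by the inverse of the unit `ι^* g`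
(`isUnit_appTop_openSubschemeOverι_basicOpen`). [cite: Hartshorne1977, II Prop. 2.2 (b)] -/
def basicOpenCoord : Fin (N + 1) → Γ((Motives.openSubschemeOver Y (Y.left.basicOpen g)).left, ⊤) :=
  Fin.snoc (fun j ↦ (Motives.openSubschemeOverι Y (Y.left.basicOpen g)).left.appTop (x j))
    ↑((isUnit_appTop_openSubschemeOverι_basicOpen (Y := Y) g).unit⁻¹)

/-- The first `N` coordinates of `Y_g` are the restrictions `ι^* xⱼ`. [cite: Hartshorne1977, II Prop. 2.2 (b)] -/
@[simp]
theorem basicOpenCoord_castSucc (j : Fin N) :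
    basicOpenCoord x g (Fin.castSucc j) =
      (Motives.openSubschemeOverι Y (Y.left.basicOpen g)).left.appTop (x j) := by
  rw [basicOpenCoord, Fin.snoc_castSucc]

/-- The last coordinate of `Y_g` is the inverse of the unit `ι^* g`. [cite: Hartshorne1977, II Prop. 2.2 (b)] -/
theorem basicOpenCoord_last :
    basicOpenCoord x g (Fin.last N) =
      ↑((isUnit_appTop_openSubschemeOverι_basicOpen (Y := Y) g).unit⁻¹) := by
  rw [basicOpenCoord, Fin.snoc_last]

/-- `x'_N · ι^* g = 1`. [cite: Hartshorne1977, II Prop. 2.2 (b)] -/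
theorem basicOpenCoord_last_mul :
    basicOpenCoord x g (Fin.last N) *
      (Motives.openSubschemeOverι Y (Y.left.basicOpen g)).left.appTop g = 1 := by
  rw [basicOpenCoord_last]
  exact (isUnit_appTop_openSubschemeOverι_basicOpen g).unit.inv_val

/-- `ι^* g · x'_N = 1`. [cite: Hartshorne1977, II Prop. 2.2 (b)] -/
theorem mul_basicOpenCoord_last :
    (Motives.openSubschemeOverι Y (Y.left.basicOpen g)).left.appTop g *
      basicOpenCoord x g (Fin.last N) = 1 := by
  rw [mul_comm]
  exact basicOpenCoord_last_mul x g

/-- **The lift `Tⱼ ↦ Tⱼ` intertwines the coordinates**: `ι^*(xⱼ) = φ_{x'}(Tⱼ)` for `j < N` — the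
hypothesis `hF` of the naturality of Grothendieck's comparison map (`deRhamComparison_map_eq`,
`regularFormRealize_pullback_anMap`, `map_le_ker_coordPresentation`) for the open immersion
`ι : Y_g ⟶ Y`. [cite: Hartshorne1977, II §3] -/
theorem appTop_eq_coordPresentation_basicOpenCoord (j : Fin N) :
    (Motives.openSubschemeOverι Y (Y.left.basicOpen g)).left.appTop (x j) =
      coordPresentation _ (basicOpenCoord x g) (basicOpenLift N j) := by
  rw [basicOpenLift_apply, coordPresentation_X, basicOpenCoord_castSucc]

/-- `φ_{x'}(f(basicOpenLift)) = ι^*(φ_x f)` (`coordPresentation_bind₁` for the lift `Tⱼ ↦ Tⱼ`).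
[cite: Hartshorne1977, II §3] -/
theorem coordPresentation_basicOpenCoord_bind₁ (f : MvPolynomial (Fin N) ℂ) :
    coordPresentation _ (basicOpenCoord x g) (bind₁ (basicOpenLift N) f) =
      (Motives.openSubschemeOverι Y (Y.left.basicOpen g)).left.appTop (coordPresentation Y x f) :=
  coordPresentation_bind₁ _ (appTop_eq_coordPresentation_basicOpenCoord x g) f

/-- **Polynomials in the first `N` coordinates of `Y_g` are restrictions**:
`φ_{x'}(f(T₀, …, T_{N-1})) = ι^*(φ_x f)`. [cite: Hartshorne1977, II §3] -/
theorem coordPresentation_basicOpenCoord_rename (f : MvPolynomial (Fin N) ℂ) :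
    coordPresentation _ (basicOpenCoord x g) (rename Fin.castSucc f) =
      (Motives.openSubschemeOverι Y (Y.left.basicOpen g)).left.appTop (coordPresentation Y x f) := by
  rw [← bind₁_basicOpenLift_apply]
  exact coordPresentation_basicOpenCoord_bind₁ x g f

/-- `φ_{x'}(T_N) · ι^*(g) = 1`. [cite: Hartshorne1977, II Prop. 2.2 (b)] -/
theorem coordPresentation_basicOpenCoord_X_last_mul :
    coordPresentation _ (basicOpenCoord x g) (X (Fin.last N)) *
      (Motives.openSubschemeOverι Y (Y.left.basicOpen g)).left.appTop g = 1 := by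
  rw [coordPresentation_X]
  exact basicOpenCoord_last_mul x g

variable {g} in
/-- `φ_{x'}(T_N · G(T₀, …, T_{N-1})) = 1` for `g = φ_x(G)`: the last coordinate inverts `g` on `Y_g`.
[cite: Hartshorne1977, II Prop. 2.2 (b)] -/
theorem coordPresentation_basicOpenCoord_X_last_mul_rename {G : MvPolynomial (Fin N) ℂ}
    (hG : coordPresentation Y x G = g) :
    coordPresentation _ (basicOpenCoord x g) (X (Fin.last N) * rename Fin.castSucc G) = 1 := by
  rw [map_mul, coordPresentation_basicOpenCoord_rename, hG]
  exact coordPresentation_basicOpenCoord_X_last_mul x g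

variable {g} in
/-- **The relation `T_N · G − 1` holds on `Y_g`** (`g = φ_x(G)`): `T_N · G(T₀, …, T_{N-1}) − 1 ∈ ker φ_{x'}`
— together with `map_rename_le_ker_coordPresentation_basicOpenCoord` the relations of the
presentation `Γ(Y_g, 𝒪) = ℂ[T₀, …, T_N]/(I, T_N · G − 1)`. [cite: Hartshorne1977, II Prop. 2.2 (b)] -/
theorem X_last_mul_rename_sub_one_mem_ker {G : MvPolynomial (Fin N) ℂ}
    (hG : coordPresentation Y x G = g) :
    X (Fin.last N) * rename Fin.castSucc G - 1 ∈
      RingHom.ker (coordPresentation _ (basicOpenCoord x g)) := by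
  rw [RingHom.mem_ker, map_sub, map_one, coordPresentation_basicOpenCoord_X_last_mul_rename x hG,
    sub_self]

/-- **Relations among the `x` restrict to relations among the `x'`**: for `I ⊆ ker φ_x`,
`I · ℂ[T₀, …, T_N] ⊆ ker φ_{x'}` (`map_le_ker_coordPresentation` for the lift `Tⱼ ↦ Tⱼ`) — the
hypothesis `hI` of the comparison maps of `Y_g` relative to those of `Y`. [cite: Hartshorne1977, II §3] -/
theorem map_basicOpenLift_le_ker_coordPresentation_basicOpenCoord
    {I : Ideal (MvPolynomial (Fin N) ℂ)} (hI : I ≤ RingHom.ker (coordPresentation Y x)) :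
    I.map (bind₁ (basicOpenLift N) : MvPolynomial (Fin N) ℂ →ₐ[ℂ] MvPolynomial (Fin (N + 1)) ℂ) ≤
      RingHom.ker (coordPresentation _ (basicOpenCoord x g)) :=
  map_le_ker_coordPresentation _ (appTop_eq_coordPresentation_basicOpenCoord x g) hI

/-- The same inclusion of relations, phrased with `rename Fin.castSucc`. [cite: Hartshorne1977, II §3] -/
theorem map_rename_le_ker_coordPresentation_basicOpenCoord
    {I : Ideal (MvPolynomial (Fin N) ℂ)} (hI : I ≤ RingHom.ker (coordPresentation Y x)) :
    I.map (rename Fin.castSucc : MvPolynomial (Fin N) ℂ →ₐ[ℂ] MvPolynomial (Fin (N + 1)) ℂ) ≤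
      RingHom.ker (coordPresentation _ (basicOpenCoord x g)) := by
  rw [← bind₁_basicOpenLift]
  exact map_basicOpenLift_le_ker_coordPresentation_basicOpenCoord x g hI

/-- `t · aⁿ = b` and `a · u = 1` give `b · uⁿ = t` (in a commutative monoid). [folklore] -/
private theorem mul_pow_eq_of_mul_pow_eq {M : Type*} [CommMonoid M] {t a u b : M} {n : ℕ}
    (key : t * a ^ n = b) (hu : a * u = 1) : b * u ^ n = t := by
  rw [← key, mul_assoc, ← mul_pow, hu, one_pow, mul_one]

/-- **`φ_{x'}` is onto when `φ_x` is**: `Γ(Y_g, 𝒪) = Γ(Y, 𝒪)_g` (Mathlib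
`AlgebraicGeometry.Γ_restrict_isLocalization`, `IsLocalization.Away.surj`), so every section over
`D(g)` is `t = ι^*(s) · (ι^* g)⁻ⁿ = φ_{x'}(S(T₀, …, T_{N-1}) · T_Nⁿ)` with `φ_x(S) = s`.
[cite: Hartshorne1977, II Prop. 2.2 (b)] -/
theorem coordPresentation_basicOpenCoord_surjective
    (hx : Function.Surjective (coordPresentation Y x)) :
    Function.Surjective (coordPresentation _ (basicOpenCoord x g)) := by
  intro t
  -- `t · (ι^* g)ⁿ = ι^* s` in `Γ(Y_g, 𝒪) = Γ(Y, 𝒪)_g`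
  obtain ⟨n, s, hs⟩ :=
    IsLocalization.Away.surj g (S := Γ((Y.left.basicOpen g : Scheme), ⊤)) t
  have key : t * (Motives.openSubschemeOverι Y (Y.left.basicOpen g)).left.appTop g ^ n =
      (Motives.openSubschemeOverι Y (Y.left.basicOpen g)).left.appTop s := by
    rw [appTop_openSubschemeOverι_eq_algebraMap, appTop_openSubschemeOverι_eq_algebraMap]
    exact hs
  -- `s = φ_x(S)`, so `t = ι^*(φ_x S) · (x'_N)ⁿ = φ_{x'}(S(T₀, …, T_{N-1}) · T_Nⁿ)`
  obtain ⟨S, hS⟩ := hx s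
  refine ⟨rename Fin.castSucc S * X (Fin.last N) ^ n, ?_⟩
  rw [map_mul, map_pow, coordPresentation_basicOpenCoord_rename, coordPresentation_X, hS]
  exact mul_pow_eq_of_mul_pow_eq key (mul_basicOpenCoord_last x g)

/-- **Coordinates of a basic open, packaged for the comparison maps**: if the affine `Y` has a
presentation `φ_x` onto `Γ(Y, 𝒪)`, then `Y_g` has the presentation `φ_{x'}`,
`x' = (ι^* x, (ι^* g)⁻¹)`, onto `Γ(Y_g, 𝒪)`, along which `ι^*` lifts to the polynomial map
`Tⱼ ↦ Tⱼ` and whose last coordinate inverts `ι^* g`. [cite: Hartshorne1977, II Prop. 2.2 (b)] -/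
theorem exists_coordPresentation_surjective_basicOpen
    (hx : Function.Surjective (coordPresentation Y x)) :
    ∃ (x' : Fin (N + 1) → Γ((Motives.openSubschemeOver Y (Y.left.basicOpen g)).left, ⊤))
      (F : Fin N → MvPolynomial (Fin (N + 1)) ℂ),
      Function.Surjective (coordPresentation _ x') ∧
        (∀ j, (Motives.openSubschemeOverι Y (Y.left.basicOpen g)).left.appTop (x j) =
          coordPresentation _ x' (F j)) ∧
        coordPresentation _ x' (X (Fin.last N)) *
          (Motives.openSubschemeOverι Y (Y.left.basicOpen g)).left.appTop g = 1 :=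
  ⟨basicOpenCoord x g, basicOpenLift N, coordPresentation_basicOpenCoord_surjective x g hx,
    appTop_eq_coordPresentation_basicOpenCoord x g, coordPresentation_basicOpenCoord_X_last_mul x g⟩

end HodgeTheory

end Literature.AlgebraicGeometry.HodgeTheory

end
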